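import Mathlib
import Literature.MathematicalPhysics.QuantumLattice.HeisenbergModel
import Literature.MathematicalPhysics.QuantumLattice.SpinChainsLiebMattisProofs
import HarnessLib

/-!
# Route `AnisotropyChord`, crux `ChordXY` (item `stmt-HubbardSuperconductivity-8146`),
# line `doob-johnson-chord`: stub `stub_tangentBound` — the AM–GM TANGENT BOUND of the condensate

Helper (`--supports stmt-HubbardSuperconductivity-8146`) for the crux
`Summit.HubbardSuperconductivity.HubbardSuperconductivity.Theses.AnisotropyChord.ChordXY`, line
`doob-johnson-chord` (lead skeleton `Cruxes/ChordXY/Lines/doob_johnson_chord.lean`), registered stub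
`stub_tangentBound` — proved here with the skeleton's abbreviations `lam`, `field`, `ofReal`, `Otot`
UNFOLDED (the skeleton closes its stub by `exact chordXY_tangentBound`).

Notation: `O = S⁺_tot S⁻_tot = (Σ_x S⁺_x)(Σ_y S⁻_y)` on the `S^z`-configuration basis of the spin-½
`M × M` torus, `Λ(φ) = Re⟨φ, O φ⟩`, and for a real amplitude `ψ ≥ 0` the Doob–Johnson LOCAL FIELD
(mixed estimator) `g_ψ(σ) = (Oψ)(σ)/ψ(σ)` (Lean's `x / 0 = 0` off the support).

* `two_mul_mul_le_sq_mul_div_add` — the per-entry AM–GM step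
  `2ab ≤ a² q/p + b² p/q` for `a, b, p, q ≥ 0` with `a ≠ 0 → p > 0`, `b ≠ 0 → q > 0`.
* `re_star_dotProduct_mulVec_le_sum_norm_sq_mul_field` — the ABSTRACT tangent bound: for any square
  matrix `O` with entries in `ℝ≥0` (as complex numbers) and `O j i = O i j`, any `ψ ≥ 0` and any complex
  amplitude `φ` with `supp φ ⊆ {ψ > 0}`: `Re⟨φ, Oφ⟩ ≤ Σ_i |φ i|² · Re(Oψ)(i)/ψ(i)`.  Proof:
  `Re(conj(φ i) O_ij φ j) ≤ O_ij |φ i| |φ j| ≤ ½ O_ij (|φ i|² ψ j/ψ i + |φ j|² ψ i/ψ j)` and the two halves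
  coincide after `i ↔ j` by symmetry of `O`.  (Equivalently: `p ↦ ⟨√p, O √p⟩` is concave and the right
  side is its tangent at `p = ψ²`; Doob (1957) h-transform / VMC mixed estimator.) [folklore]
* `condensate_apply_nonneg`, `condensate_apply_symm` — the entries of `O = S⁺_tot S⁻_tot` are real
  `≥ 0` (entries of `S^±_x` are `0`, `1`) and `O` is symmetric (`S⁻_tot = (S⁺_tot)ᴴ`, real entries).
* `chordXY_tangentBound` — the registered stub BY SIGNATURE:
  `∀ M [NeZero M] ψ φ, (∀ σ, 0 ≤ ψ σ) → (∀ σ, φ σ ≠ 0 → 0 < ψ σ) → Λ(φ) ≤ Σ_σ ‖φ σ‖² g_ψ(σ)`.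

Elementary finite-sum algebra; no definition and no named fact is introduced; sorry-free.
HONEST: this is the true, easy stub of the line; nothing here proves `ChordXY` (the hard stub
`stub_frozenFieldChord` is open) and superconductivity in the Hubbard model is not advanced.
-/

set_option linter.dupNamespace false

noncomputable section

namespace Summit.HubbardSuperconductivity.HubbardSuperconductivity.Theorems.AnisotropyChord

open Matrix Complex Finset
open scoped ComplexOrder ComplexConjugate
open Literature.MathematicalPhysics.QuantumLattice Literature.Probability.LatticeModels

/-! ### The per-entry AM–GM step -/

/-- AM–GM with weights: `2ab ≤ a² q/p + b² p/q` for `a, b, p, q ≥ 0`, provided `p > 0` whenever `a ≠ 0`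
and `q > 0` whenever `b ≠ 0` (the degenerate cases use Lean's `x / 0 = 0`). [folklore] -/
theorem two_mul_mul_le_sq_mul_div_add (a b p q : ℝ) (ha : 0 ≤ a) (hb : 0 ≤ b) (hp : 0 ≤ p)
    (hq : 0 ≤ q) (hap : a ≠ 0 → 0 < p) (hbq : b ≠ 0 → 0 < q) :
    2 * (a * b) ≤ a ^ 2 * q / p + b ^ 2 * p / q := by
  by_cases ha0 : a = 0
  · subst ha0
    have : 0 ≤ b ^ 2 * p / q := div_nonneg (mul_nonneg (sq_nonneg b) hp) hq
    simpa using this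
  by_cases hb0 : b = 0
  · subst hb0
    have : 0 ≤ a ^ 2 * q / p := div_nonneg (mul_nonneg (sq_nonneg a) hq) hp
    simpa using this
  have hp' : 0 < p := hap ha0
  have hq' : 0 < q := hbq hb0
  rw [div_add_div _ _ hp'.ne' hq'.ne', le_div_iff₀ (mul_pos hp' hq')]
  nlinarith [sq_nonneg (a * q - b * p), mul_nonneg ha hb, mul_nonneg hp hq]

/-! ### The abstract tangent bound -/

/-- **AM–GM tangent bound (abstract form).** For a square complex matrix `O` with entries in `ℝ≥0` and
`O j i = O i j`, a real `ψ ≥ 0`, and a complex amplitude `φ` supported inside `{ψ > 0}`: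
`Re⟨φ, O φ⟩ ≤ Σ_i ‖φ i‖² · Re((Oψ) i)/ψ i` — the tangent of the concave functional `p ↦ ⟨√p, O√p⟩` at
`p = ψ²` (Doob h-transform / Johnson–VMC mixed estimator). [folklore] -/
theorem re_star_dotProduct_mulVec_le_sum_norm_sq_mul_field {ι : Type*} [Fintype ι] [DecidableEq ι]
    (O : Matrix ι ι ℂ) (hO : ∀ i j, 0 ≤ O i j) (hsymm : ∀ i j, O j i = O i j)
    (ψ : ι → ℝ) (φ : ι → ℂ) (hψ : ∀ i, 0 ≤ ψ i) (hsupp : ∀ i, φ i ≠ 0 → 0 < ψ i) :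
    (star φ ⬝ᵥ (O *ᵥ φ)).re ≤
      ∑ i, ‖φ i‖ ^ 2 * (((O *ᵥ fun j => ((ψ j : ℝ) : ℂ)) i).re / ψ i) := by
  -- the entries of `O` as real numbers
  have hex : ∃ o : ι → ι → ℝ, (∀ i j, 0 ≤ o i j) ∧ (∀ i j, o j i = o i j) ∧
      ∀ i j, O i j = ((o i j : ℝ) : ℂ) := by
    refine ⟨fun i j => (O i j).re, fun i j => (Complex.le_def.mp (hO i j)).1, fun i j => by
      show (O j i).re = (O i j).re
      rw [hsymm], fun i j => Complex.ext (by simp) ?_⟩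
    have h := (Complex.le_def.mp (hO i j)).2
    simp only [Complex.zero_im] at h
    simp [← h]
  obtain ⟨o, ho_nn, ho_symm, hOeq⟩ := hex
  -- the left side as a real double sum
  have hL : (star φ ⬝ᵥ (O *ᵥ φ)).re = ∑ i, ∑ j, o i j * (conj (φ i) * φ j).re := by
    simp only [dotProduct, mulVec, Pi.star_apply, Finset.mul_sum, Complex.re_sum]
    refine Finset.sum_congr rfl fun i _ => Finset.sum_congr rfl fun j _ => ?_
    rw [hOeq, Complex.star_def]
    have h : conj (φ i) * (((o i j : ℝ) : ℂ) * φ j) = ((o i j : ℝ) : ℂ) * (conj (φ i) * φ j) := by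
      ring
    rw [h, Complex.re_ofReal_mul]
  -- the right side as a real double sum
  have hR : ∑ i, ‖φ i‖ ^ 2 * (((O *ᵥ fun j => ((ψ j : ℝ) : ℂ)) i).re / ψ i) =
      ∑ i, ∑ j, o i j * (‖φ i‖ ^ 2 * ψ j / ψ i) := by
    refine Finset.sum_congr rfl fun i _ => ?_
    have h1 : ((O *ᵥ fun j => ((ψ j : ℝ) : ℂ)) i).re = ∑ j, o i j * ψ j := by
      simp only [mulVec, dotProduct, Complex.re_sum]
      refine Finset.sum_congr rfl fun j _ => ?_
      rw [hOeq, ← Complex.ofReal_mul, Complex.ofReal_re]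
    rw [h1, Finset.sum_div, Finset.mul_sum]
    refine Finset.sum_congr rfl fun j _ => ?_
    ring
  rw [hL, hR]
  -- `Re(conj a · b) ≤ |a| |b|`
  have hS : ∑ i, ∑ j, o i j * (conj (φ i) * φ j).re ≤ ∑ i, ∑ j, o i j * (‖φ i‖ * ‖φ j‖) := by
    refine Finset.sum_le_sum fun i _ => Finset.sum_le_sum fun j _ => ?_
    refine mul_le_mul_of_nonneg_left ?_ (ho_nn i j)
    calc (conj (φ i) * φ j).re ≤ ‖conj (φ i) * φ j‖ := Complex.re_le_norm _
      _ = ‖φ i‖ * ‖φ j‖ := by rw [norm_mul, Complex.norm_conj]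
  refine hS.trans ?_
  -- AM–GM per entry, then symmetrise
  have hsupp' : ∀ i, ‖φ i‖ ≠ 0 → 0 < ψ i := fun i h => hsupp i (fun h0 => h (by rw [h0, norm_zero]))
  have hT : ∑ i, ∑ j, o i j * (‖φ i‖ ^ 2 * ψ j / ψ i) = ∑ i, ∑ j, o i j * (‖φ j‖ ^ 2 * ψ i / ψ j) := by
    rw [Finset.sum_comm]
    refine Finset.sum_congr rfl fun i _ => Finset.sum_congr rfl fun j _ => ?_
    rw [ho_symm i j]
  have h2 : 2 * ∑ i, ∑ j, o i j * (‖φ i‖ * ‖φ j‖) ≤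
      ∑ i, ∑ j, o i j * (‖φ i‖ ^ 2 * ψ j / ψ i) + ∑ i, ∑ j, o i j * (‖φ j‖ ^ 2 * ψ i / ψ j) := by
    rw [Finset.mul_sum, ← Finset.sum_add_distrib]
    refine Finset.sum_le_sum fun i _ => ?_
    rw [Finset.mul_sum, ← Finset.sum_add_distrib]
    refine Finset.sum_le_sum fun j _ => ?_
    have hp := two_mul_mul_le_sq_mul_div_add (‖φ i‖) (‖φ j‖) (ψ i) (ψ j) (norm_nonneg _)
      (norm_nonneg _) (hψ i) (hψ j) (hsupp' i) (hsupp' j)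
    calc 2 * (o i j * (‖φ i‖ * ‖φ j‖)) = o i j * (2 * (‖φ i‖ * ‖φ j‖)) := by ring
      _ ≤ o i j * (‖φ i‖ ^ 2 * ψ j / ψ i + ‖φ j‖ ^ 2 * ψ i / ψ j) :=
          mul_le_mul_of_nonneg_left hp (ho_nn i j)
      _ = o i j * (‖φ i‖ ^ 2 * ψ j / ψ i) + o i j * (‖φ j‖ ^ 2 * ψ i / ψ j) := by ring
  linarith [hT]

/-! ### Entrywise facts of `O = S⁺_tot S⁻_tot` -/

/-- A single-site operator with entries in `ℝ≥0` has entries in `ℝ≥0` (they are entries of `a` or `0`).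
[folklore] -/
theorem onSite_apply_nonneg {Λ : Type*} [Fintype Λ] [DecidableEq Λ] {q : ℕ} (x : Λ)
    (a : Matrix (Fin q) (Fin q) ℂ) (ha : ∀ k l, 0 ≤ a k l) (σ τ : TensorIndex Λ q) :
    0 ≤ onSite x a σ τ := by
  rw [onSite_apply]
  split_ifs
  · exact ha _ _
  · exact le_rfl

/-- The entries of `S⁺` (spin `n/2`) are real `≥ 0` (`√((k+1)(n-k))` or `0`). [folklore] -/
theorem spinRaise_apply_nonneg (n : ℕ) (k l : Fin (n + 1)) : 0 ≤ spinRaise n k l := by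
  rw [spinRaise_apply]
  split_ifs
  · exact Complex.zero_le_real.mpr (Real.sqrt_nonneg _)
  · exact le_rfl

/-- The entries of `S⁻ = (S⁺)ᴴ` are real `≥ 0`. [folklore] -/
theorem spinLower_apply_nonneg (n : ℕ) (k l : Fin (n + 1)) : 0 ≤ spinLower n k l := by
  rw [spinLower_eq_conjTranspose, conjTranspose_apply]
  exact star_nonneg_iff.mpr (spinRaise_apply_nonneg n l k)

/-- The entries of `S⁺_tot = Σ_x S⁺_x` are real `≥ 0`. [folklore] -/
theorem raiseTot_apply_nonneg {Λ : Type*} [Fintype Λ] [DecidableEq Λ] (n : ℕ)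
    (σ τ : TensorIndex Λ (n + 1)) : 0 ≤ (∑ x : Λ, onSite x (spinRaise n)) σ τ := by
  rw [Matrix.sum_apply]
  exact Finset.sum_nonneg fun x _ => onSite_apply_nonneg x _ (spinRaise_apply_nonneg n) σ τ

/-- The entries of `S⁻_tot = Σ_y S⁻_y` are real `≥ 0`. [folklore] -/
theorem lowerTot_apply_nonneg {Λ : Type*} [Fintype Λ] [DecidableEq Λ] (n : ℕ)
    (σ τ : TensorIndex Λ (n + 1)) : 0 ≤ (∑ y : Λ, onSite y (spinLower n)) σ τ := by
  rw [Matrix.sum_apply]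
  exact Finset.sum_nonneg fun y _ => onSite_apply_nonneg y _ (spinLower_apply_nonneg n) σ τ

/-- **The condensate operator `O = S⁺_tot S⁻_tot` has entries in `ℝ≥0`** in the `S^z`-configuration
basis (any finite set of sites, any spin). [folklore] -/
theorem condensate_apply_nonneg {Λ : Type*} [Fintype Λ] [DecidableEq Λ] (n : ℕ)
    (σ τ : TensorIndex Λ (n + 1)) :
    0 ≤ ((∑ x : Λ, onSite x (spinRaise n)) * (∑ y : Λ, onSite y (spinLower n))) σ τ := by
  rw [Matrix.mul_apply]
  exact Finset.sum_nonneg fun ρ _ =>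
    mul_nonneg (raiseTot_apply_nonneg n σ ρ) (lowerTot_apply_nonneg n ρ τ)

/-- The entries of `S⁺_tot` are real: `star (S⁺_tot σ τ) = S⁺_tot σ τ`. [folklore] -/
theorem star_raiseTot_apply {Λ : Type*} [Fintype Λ] [DecidableEq Λ] (n : ℕ)
    (σ τ : TensorIndex Λ (n + 1)) :
    star ((∑ x : Λ, onSite x (spinRaise n)) σ τ) = (∑ x : Λ, onSite x (spinRaise n)) σ τ := by
  have h := (Complex.le_def.mp (raiseTot_apply_nonneg n σ τ)).2
  rw [Complex.zero_im] at h
  rw [Complex.star_def, Complex.conj_eq_iff_im, ← h]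

/-- **The condensate operator `O = S⁺_tot S⁻_tot` is symmetric** in the `S^z`-configuration basis:
`O τ σ = O σ τ` (`S⁻_tot = (S⁺_tot)ᴴ` and the entries of `S⁺_tot` are real). [folklore] -/
theorem condensate_apply_symm {Λ : Type*} [Fintype Λ] [DecidableEq Λ] (n : ℕ)
    (σ τ : TensorIndex Λ (n + 1)) :
    ((∑ x : Λ, onSite x (spinRaise n)) * (∑ y : Λ, onSite y (spinLower n))) τ σ =
      ((∑ x : Λ, onSite x (spinRaise n)) * (∑ y : Λ, onSite y (spinLower n))) σ τ := by
  have hP : (∑ y : Λ, onSite y (spinLower n)) = (∑ x : Λ, onSite x (spinRaise n))ᴴ :=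
    lowerOn_eq_conjTranspose n (Finset.univ : Finset Λ)
  rw [hP, Matrix.mul_apply, Matrix.mul_apply]
  refine Finset.sum_congr rfl fun ρ _ => ?_
  rw [conjTranspose_apply, conjTranspose_apply, star_raiseTot_apply, star_raiseTot_apply, mul_comm]

/-! ### The registered stub -/

/-- **Registered stub `stub_tangentBound` (line `doob-johnson-chord` of crux `ChordXY`, skeleton
`Cruxes/ChordXY/Lines/doob_johnson_chord.lean`), BY SIGNATURE with `lam`/`field`/`ofReal`/`Otot`
unfolded** — the AM–GM tangent bound of the condensate at a non-negative amplitude: for every `M`, every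
real `ψ ≥ 0` and every complex amplitude `φ` on the `S^z`-configurations of the spin-½ `M × M` torus with
`φ σ ≠ 0 → ψ σ > 0`,
`Re⟨φ, S⁺_tot S⁻_tot φ⟩ ≤ Σ_σ ‖φ σ‖² · Re(S⁺_tot S⁻_tot ψ)(σ)/ψ(σ)`.
Doob (1957) h-transform / Johnson's mixed estimator. [folklore] -/
theorem chordXY_tangentBound :
    ∀ (M : ℕ) [NeZero M] (ψ : TensorIndex (TorusSite 2 M) 2 → ℝ)
      (φ : TensorIndex (TorusSite 2 M) 2 → ℂ),
      (∀ σ, 0 ≤ ψ σ) → (∀ σ, φ σ ≠ 0 → 0 < ψ σ) →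
        (star φ ⬝ᵥ (((∑ x : TorusSite 2 M, onSite x (spinRaise 1)) *
            (∑ y : TorusSite 2 M, onSite y (spinLower 1))) *ᵥ φ)).re ≤
          ∑ σ, ‖φ σ‖ ^ 2 *
            (((((∑ x : TorusSite 2 M, onSite x (spinRaise 1)) *
                (∑ y : TorusSite 2 M, onSite y (spinLower 1))) *ᵥ
              (fun τ => ((ψ τ : ℝ) : ℂ))) σ).re / ψ σ) := by
  intro M _ ψ φ hψ hsupp
  exact re_star_dotProduct_mulVec_le_sum_norm_sq_mul_field _ (condensate_apply_nonneg 1)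
    (condensate_apply_symm 1) ψ φ hψ hsupp

end Summit.HubbardSuperconductivity.HubbardSuperconductivity.Theorems.AnisotropyChord

end
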